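import Literature.Probability.LatticeModels.RandomClusterComparison
import Literature.Probability.LatticeModels.RandomClusterDomainMarkov
import Literature.Barriers.CriticalPhenomena.RandomClusterFirstOrder
import HarnessLib

/-!
# From a lattice domain to the wired box: `φ^B_{H,p,q}(v ↔ ∂Λ inside Λ) ≤ φ¹_{Λ,p,q}(0 ↔ ∂Λ)`

Topic `Literature/Probability/LatticeModels`. The probabilistic heart of the a priori estimate of
S. Smirnov, *Conformal invariance in random cluster models. I*, Ann. of Math. 172 (2010),
Appendix A, proof of Lemma A.1 (arXiv:0708.0039, "Lemma 6.1"): the chain of comparisons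

  `P(B ↔ wired arc) ≤ P(B ↔ ∂Q inside Ω; arcs wired/free) ≤ P(B ↔ ∂Q inside Ω; ∂Ω ∖ Q wired)`
  `  ≤ P(B ↔ ∂Q inside Ω; Ω ∩ ∂Q wired) ≤ P(B ↔ ∂Q inside Q; ∂Q wired)`

("by monotonicity"), i.e. the domain Markov property and the comparison between boundary conditions
of the random-cluster model (G. Grimmett, *The Random-Cluster Model* (2006), Lemma (4.13), Lemma
(4.14), Thm. (3.21) and eq. (4.24)), in the generality of an **arbitrary finite graph embedded in `ℤ²`**:

* `rcMeasure_real_domainArmEvent_le`: let `H` be a finite graph on `M`, `ι : M ↪ ℤ²` an injection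
  sending edges to lattice edges, `B ⊆ M` a wired set, `v : M`, and suppose no point of `B` lies at
  sup-distance `≤ n` from `ι v`. Then for `0 ≤ p ≤ 1`, `q ≥ 1`, the `φ^B_{H,p,q}`-probability
  (`rcMeasure H p q B`, `RandomCluster.lean`) that `v` is joined to the sphere of radius `n + 1`
  around `ι v` by open edges inside the ball (`domainArmEvent`) is at most
  `φ¹_{Λ_{n+1},p,q}(0 ↔ ∂Λ_{n+1}) = thetaWiredBox 2 p q (n + 1)`
  (`Literature.Barriers.CriticalPhenomena.RandomClusterFirstOrder`).

Applied in `Sweep1Proofs.lean` to H21's FK-Ising Dobrushin measure (`H` = the interface graph of a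
discretised Jordan domain, `B` = the wired arc), this is Smirnov's displayed chain up to its last
line (the identification with the Ising magnetisation, Edwards–Sokal, and Yang's theorem).

## The argument (one application of Holley's inequality)

Rather than composing a conditional-measure identity, two comparisons of boundary conditions and an
edge-deletion comparison, everything is obtained from **one** application of Holley's inequality
(Mathlib `holley`, Holley 1974) on the lattice of edge sets of a common finite vertex type
`U = ι(M) ∪ Λ_{n+1}` (`JointV`):

* the *domain weights* `domWeight` are the random-cluster weights of `H` transported to `U` (the
  points of the box off the domain become isolated vertices, which shifts the cluster count by a
  constant: `card_connectedComponent_image_eq_add`);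
* the *box weights* `boxWeight` are the wired weights of `Λ_{n+1}` — with **every** vertex of `U` off
  the open box `Λ_n` wired, which on the box is the usual wiring of `∂Λ_{n+1}` (the extra vertices
  join the wired cluster: `card_connectedComponent_image_eq`) — coupled with the deterministic
  configuration "all domain edges off the box open", so that its support is a filter of the lattice
  and Holley's condition can hold with the domain weights as the dominated side;
* Holley's condition `domWeight_mul_boxWeight_le`: the `p`-exponents balance exactly, and the
  cluster counts satisfy `k_D(a) + k_□(b₄) ≤ k_D(a ⊓ b) + k_□(a₄ ∪ b₄)` by the *mixed
  supermodularity* `k(H ⊔ S) + k(H') ≤ k(H) + k(H' ⊔ S)` for `H ≤ H'`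
  (`card_connectedComponent_sup_le_of_le`, from Grimmett's (3.12)), applied to
  `H = (a ⊓ b) ⊔ W_B ≤ H' = b₄ ⊔ W_□` — this inequality of graphs is where the geometry enters:
  domain edges off the box and the wired set `B` lie inside the wired set of the box world
  (`fromEdgeSet_outEdges_le`);
* the increasing function is the indicator of the arm event read on `U` (`jointArm`), which is the
  arm event of the domain on transported domain configurations (`jointArm_map_iff`) and
  `{0 ↔ ∂Λ_{n+1}}` on coupled box configurations (`jointArm_box_iff`); the two Holley sums are the
  two random-cluster probabilities (`sum_mul_domWeight`, `sum_mul_boxWeight`).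

The centred statement (`ι v = 0`, `rcMeasure_real_domainArmEvent₀_le`) is translated to general
position by composing `ι` with a translation (`rcMeasure_real_domainArmEvent_le`).

## What is not here

The symmetric statement for *decreasing* events / free boundary conditions (dual arms near the
wired arc), which in the plane requires the self-duality of the random-cluster measure on boxes
(Grimmett 2006, §6.1) — not in the tree; and any infinite-volume statement.

## References

* S. Smirnov, Ann. of Math. 172 (2010) 1435–1467, Appendix A, Lemma A.1 — bib key `Smirnov2010`.
* G. Grimmett, *The Random-Cluster Model*, Springer 2006: §1.2 (1.2); Thm. (3.21) (comparison via
  Holley); eq. (3.12) (supermodularity of `k`); §4.2 (4.11)–(4.13), Lemma (4.13) (domain Markov),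
  Lemma (4.14) and (4.24) (comparison of boundary conditions / domains); Prop. (5.11)
  (`φ¹_Λ(0 ↔ ∂Λ)`) — bib key `Grimmett2006`.
* R. Holley, Comm. Math. Phys. 36 (1974) 227–231 — Mathlib `holley`.

Mathlib anchors: `holley` (`Mathlib.Combinatorics.SetFamily.FourFunctions`),
`SimpleGraph.ConnectedComponent.lift`/`.map`, `SimpleGraph.map`, `Function.Embedding.sym2Map`,
`Finset.sum_nbij`, `Finset.subset_map_iff`, `SimpleGraph.ConnectedComponent.card_le_card_of_le`;
from the tree: `rcMeasure`, `rcWeight`, `clusterCount`, `wired` (`RandomCluster`),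
`card_connectedComponent_supermodular`, `rcMeasure_real_apply` (`RandomClusterFKG`),
`rcMeasure_real_eq_sum_div`, `innerBoundary_box_nonempty`, `mem_innerBoundary_box_of_apply_eq(_neg)`
(`RandomClusterDomainMarkov`), `thetaWiredBox`, `boxGraph`, `boxBoundary`, `boxOrigin`
(`Barriers/CriticalPhenomena/RandomClusterFirstOrder`).
-/

noncomputable section

namespace Literature.Probability.LatticeModels

open SimpleGraph Finset
open Literature.Barriers.CriticalPhenomena


open SimpleGraph Finset

/-! ### Mixed supermodularity of the number of connected components -/

/-- **Adding edges merges at least as many clusters in a poorer environment.** For graphs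
`H ≤ H'` and any `S` on a finite vertex set, `k(H ⊔ S) + k(H') ≤ k(H) + k(H' ⊔ S)`: from the
supermodularity `k(H₁) + k(H₂) ≤ k(H₁ ⊓ H₂) + k(H₁ ⊔ H₂)` (Grimmett 2006, (3.12)) with
`H₁ = H ⊔ S`, `H₂ = H'`, and `H ≤ H₁ ⊓ H₂`. [cite: Grimmett2006, Thm. 3.8, eq. (3.12)] -/
theorem card_connectedComponent_sup_le_of_le {U : Type*} [Finite U] {H H' : SimpleGraph U}
    (S : SimpleGraph U) (hle : H ≤ H') :
    Nat.card (H ⊔ S).ConnectedComponent + Nat.card H'.ConnectedComponent ≤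
      Nat.card H.ConnectedComponent + Nat.card (H' ⊔ S).ConnectedComponent := by
  have h1 := card_connectedComponent_supermodular (H ⊔ S) H'
  have h2 : Nat.card ((H ⊔ S) ⊓ H').ConnectedComponent ≤ Nat.card H.ConnectedComponent :=
    ConnectedComponent.card_le_card_of_le (le_inf le_sup_left hle)
  have h3 : (H ⊔ S) ⊔ H' = H' ⊔ S := by
    rw [sup_right_comm, sup_eq_right.2 hle]
  rw [h3] at h1
  omega

/-! ### Transport of the wired open graph along an injection of vertex types -/

section Transport

variable {V U : Type*} (j : V ↪ U)

/-- The wired open graph of a configuration. [cite: Grimmett2006, §1.2 and §4.2] -/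
abbrev wiredOpenGraph (ω : Set (Sym2 V)) (B : Set V) : SimpleGraph V :=
  Percolation.openGraph ω ⊔ wired B

/-- An injection of vertex types maps the wired open graph of `(ω, B)` into the wired open graph
of the image configuration `(j ω, B')` whenever `j '' B ⊆ B'`, as a graph homomorphism.
[folklore] -/
def wiredOpenGraphHom (ω : Set (Sym2 V)) (B : Set V) (B' : Set U) (hB : ∀ x ∈ B, j x ∈ B') :
    wiredOpenGraph ω B →g wiredOpenGraph (Sym2.map j '' ω) B' where
  toFun := j
  map_rel' := by
    intro x y hxy
    rw [sup_adj, Percolation.openGraph_adj, wired_adj] at hxy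
    rw [sup_adj, Percolation.openGraph_adj, wired_adj]
    rcases hxy with ⟨he, hne⟩ | ⟨hne, hx, hy⟩
    · exact Or.inl ⟨⟨s(x, y), he, Sym2.map_mk _ _ _⟩, fun h => hne (j.injective h)⟩
    · exact Or.inr ⟨fun h => hne (j.injective h), hB x hx, hB y hy⟩

/-- An open edge of the image configuration comes from an open edge. [folklore] -/
theorem mem_of_map_mem_image {ω : Set (Sym2 V)} {x y : V}
    (h : s(j x, j y) ∈ Sym2.map j '' ω) : s(x, y) ∈ ω := by
  obtain ⟨e, he, hexy⟩ := h
  have : e = s(x, y) := Sym2.map.injective j.injective (hexy.trans (Sym2.map_mk _ _ _).symm)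
  exact this ▸ he

/-- The endpoints of an open edge of the image configuration lie in the range of `j`. [folklore] -/
theorem mem_range_of_mem_image {ω : Set (Sym2 V)} {u w : U} (h : s(u, w) ∈ Sym2.map j '' ω) :
    u ∈ Set.range j ∧ w ∈ Set.range j := by
  obtain ⟨e, -, heuw⟩ := h
  induction e using Sym2.ind with
  | h x y =>
    rw [Sym2.map_mk, Sym2.eq_iff] at heuw
    rcases heuw with ⟨rfl, rfl⟩ | ⟨rfl, rfl⟩
    · exact ⟨⟨x, rfl⟩, ⟨y, rfl⟩⟩
    · exact ⟨⟨y, rfl⟩, ⟨x, rfl⟩⟩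

/-- Adjacency of images in the wired open graph of the image configuration, with wired set
exactly `j '' B`, is adjacency in the wired open graph of `(ω, B)`. [folklore] -/
theorem wiredOpenGraph_image_adj_iff (ω : Set (Sym2 V)) (B : Set V) (x y : V) :
    (wiredOpenGraph (Sym2.map j '' ω) (j '' B)).Adj (j x) (j y) ↔ (wiredOpenGraph ω B).Adj x y := by
  rw [sup_adj, Percolation.openGraph_adj, wired_adj, sup_adj, Percolation.openGraph_adj, wired_adj,
    j.injective.ne_iff, j.injective.mem_set_image, j.injective.mem_set_image]
  constructor
  · rintro (⟨he, hne⟩ | h)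
    · exact Or.inl ⟨mem_of_map_mem_image j he, hne⟩
    · exact Or.inr h
  · rintro (⟨he, hne⟩ | h)
    · exact Or.inl ⟨⟨s(x, y), he, Sym2.map_mk _ _ _⟩, hne⟩
    · exact Or.inr h

/-- **Isolated extra vertices.** Transporting a configuration and its wired set along an injection
of vertex types adds one cluster per vertex outside the range:
`k^{jB}_U(jω) = k^B_V(ω) + #(U ∖ j(V))`. [folklore] -/
theorem card_connectedComponent_image_eq_add [Finite U] (ω : Set (Sym2 V)) (B : Set V) :
    Nat.card (wiredOpenGraph (Sym2.map j '' ω) (j '' B)).ConnectedComponent =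
      Nat.card (wiredOpenGraph ω B).ConnectedComponent + Nat.card {u : U // u ∉ Set.range j} := by
  classical
  set G₁ := wiredOpenGraph ω B
  set G₂ := wiredOpenGraph (Sym2.map j '' ω) (j '' B)
  have hB : ∀ x ∈ B, j x ∈ j '' B := fun x hx => ⟨x, hx, rfl⟩
  set φ : G₁ →g G₂ := wiredOpenGraphHom j ω B (j '' B) hB
  -- adjacent vertices of `G₂` lie in the range
  have hrange : ∀ {u w : U}, G₂.Adj u w → u ∈ Set.range j ∧ w ∈ Set.range j := by
    intro u w h
    rw [sup_adj, Percolation.openGraph_adj, wired_adj] at h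
    rcases h with ⟨he, -⟩ | ⟨-, ⟨x, -, rfl⟩, ⟨y, -, rfl⟩⟩
    · exact mem_range_of_mem_image j he
    · exact ⟨⟨x, rfl⟩, ⟨y, rfl⟩⟩
  -- the potential
  set ψ : U → G₁.ConnectedComponent ⊕ {u : U // u ∉ Set.range j} := fun u =>
    if h : u ∈ Set.range j then Sum.inl (G₁.connectedComponentMk h.choose) else Sum.inr ⟨u, h⟩
    with hψ
  have hψj : ∀ x, ψ (j x) = Sum.inl (G₁.connectedComponentMk x) := by
    intro x
    have h : j x ∈ Set.range j := ⟨x, rfl⟩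
    simp only [hψ, h, ↓reduceDIte]
    congr 2
    exact j.injective h.choose_spec
  have hψadj : ∀ {u w : U}, G₂.Adj u w → ψ u = ψ w := by
    intro u w h
    obtain ⟨⟨x, rfl⟩, ⟨y, rfl⟩⟩ := hrange h
    rw [hψj, hψj, Sum.inl.injEq, ConnectedComponent.eq]
    exact ((wiredOpenGraph_image_adj_iff j ω B x y).1 h).reachable
  have hψwalk : ∀ {u w : U} (p : G₂.Walk u w), ψ u = ψ w := by
    intro u w p
    induction p with
    | nil => rfl
    | cons h _ ih => exact (hψadj h).trans ih
  set Ψ : G₂.ConnectedComponent → G₁.ConnectedComponent ⊕ {u : U // u ∉ Set.range j} :=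
    ConnectedComponent.lift ψ (fun u w p _ => hψwalk p) with hΨ
  set Φ : G₁.ConnectedComponent ⊕ {u : U // u ∉ Set.range j} → G₂.ConnectedComponent :=
    Sum.elim (ConnectedComponent.map φ) (fun u => G₂.connectedComponentMk u.1) with hΦ
  have hΨΦ : ∀ c, Ψ (Φ c) = c := by
    rintro (c | u)
    · induction c using ConnectedComponent.ind with
      | h x =>
        simp only [hΦ, Sum.elim_inl, ConnectedComponent.map_mk, hΨ, ConnectedComponent.lift_mk]
        exact hψj x
    · simp only [hΦ, Sum.elim_inr, hΨ, ConnectedComponent.lift_mk, hψ, u.2, ↓reduceDIte]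
  have hΦΨ : ∀ C, Φ (Ψ C) = C := by
    intro C
    induction C using ConnectedComponent.ind with
    | h u =>
      simp only [hΨ, ConnectedComponent.lift_mk]
      by_cases h : u ∈ Set.range j
      · obtain ⟨x, rfl⟩ := h
        rw [hψj]
        simp only [hΦ, Sum.elim_inl, ConnectedComponent.map_mk]
        rfl
      · simp only [hψ, h, ↓reduceDIte, hΦ, Sum.elim_inr]
  let e : G₂.ConnectedComponent ≃ G₁.ConnectedComponent ⊕ {u : U // u ∉ Set.range j} :=
    ⟨Ψ, Φ, hΦΨ, hΨΦ⟩
  haveI : Finite V := Finite.of_injective j j.injective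
  rw [Nat.card_congr e, Nat.card_sum]

/-- **Wired extra vertices.** If the wired set `W` is nonempty and the wired set on the target
type consists of the images of `W` together with all vertices outside the range (i.e. `u ∈ W'`
iff every preimage of `u` lies in `W`), transporting does not change the number of clusters:
`k^{W'}_U(jω) = k^W_V(ω)`. [folklore] -/
theorem card_connectedComponent_image_eq [Finite U] (ω : Set (Sym2 V)) {W : Set V}
    (hW : W.Nonempty) {W' : Set U} (hW' : ∀ u, u ∈ W' ↔ ∀ x, j x = u → x ∈ W) :
    Nat.card (wiredOpenGraph (Sym2.map j '' ω) W').ConnectedComponent =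
      Nat.card (wiredOpenGraph ω W).ConnectedComponent := by
  classical
  obtain ⟨w₀, hw₀⟩ := hW
  set G₁ := wiredOpenGraph ω W
  set G₂ := wiredOpenGraph (Sym2.map j '' ω) W'
  have hjW : ∀ x, j x ∈ W' ↔ x ∈ W := fun x =>
    ⟨fun h => (hW' _).1 h x rfl, fun h => (hW' _).2 fun y hy => (j.injective hy) ▸ h⟩
  have hout : ∀ u, u ∉ Set.range j → u ∈ W' := fun u hu =>
    (hW' u).2 fun x hx => absurd ⟨x, hx⟩ hu
  set φ : G₁ →g G₂ := wiredOpenGraphHom j ω W W' (fun x hx => (hjW x).2 hx)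
  -- the potential
  set ψ : U → G₁.ConnectedComponent := fun u =>
    if h : u ∈ Set.range j then G₁.connectedComponentMk h.choose else G₁.connectedComponentMk w₀
    with hψ
  have hψj : ∀ x, ψ (j x) = G₁.connectedComponentMk x := by
    intro x
    have h : j x ∈ Set.range j := ⟨x, rfl⟩
    simp only [hψ, h, ↓reduceDIte]
    congr 1
    exact j.injective h.choose_spec
  have hψout : ∀ u, u ∉ Set.range j → ψ u = G₁.connectedComponentMk w₀ := fun u hu => by
    simp only [hψ, hu, ↓reduceDIte]
  -- in `G₁`, two vertices of `W` have the same cluster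
  have hWW : ∀ {x y : V}, x ∈ W → y ∈ W → G₁.connectedComponentMk x = G₁.connectedComponentMk y := by
    intro x y hx hy
    rw [ConnectedComponent.eq]
    by_cases hxy : x = y
    · rw [hxy]
    · refine Adj.reachable ?_
      rw [sup_adj, wired_adj]
      exact Or.inr ⟨hxy, hx, hy⟩
  have hψadj : ∀ {u w : U}, G₂.Adj u w → ψ u = ψ w := by
    intro u w h
    rw [sup_adj, Percolation.openGraph_adj, wired_adj] at h
    rcases h with ⟨he, hne⟩ | ⟨hne, hu, hw⟩
    · obtain ⟨⟨x, rfl⟩, ⟨y, rfl⟩⟩ := mem_range_of_mem_image j he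
      rw [hψj, hψj, ConnectedComponent.eq]
      refine Adj.reachable ?_
      rw [sup_adj, Percolation.openGraph_adj]
      exact Or.inl ⟨mem_of_map_mem_image j he, fun h => hne (congrArg j h)⟩
    · -- a wired pair: every case gives the cluster of `W`
      have key : ∀ z, z ∈ W' → ∃ x ∈ W, ψ z = G₁.connectedComponentMk x := by
        intro z hz
        by_cases hzr : z ∈ Set.range j
        · obtain ⟨x, rfl⟩ := hzr
          exact ⟨x, (hjW x).1 hz, hψj x⟩
        · exact ⟨w₀, hw₀, hψout z hzr⟩
      obtain ⟨x, hx, hux⟩ := key u hu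
      obtain ⟨y, hy, hwy⟩ := key w hw
      rw [hux, hwy]
      exact hWW hx hy
  have hψwalk : ∀ {u w : U} (p : G₂.Walk u w), ψ u = ψ w := by
    intro u w p
    induction p with
    | nil => rfl
    | cons h _ ih => exact (hψadj h).trans ih
  set Ψ : G₂.ConnectedComponent → G₁.ConnectedComponent :=
    ConnectedComponent.lift ψ (fun u w p _ => hψwalk p) with hΨ
  set Φ : G₁.ConnectedComponent → G₂.ConnectedComponent := ConnectedComponent.map φ with hΦ
  have hΨΦ : ∀ c, Ψ (Φ c) = c := by
    intro c
    induction c using ConnectedComponent.ind with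
    | h x =>
      simp only [hΦ, ConnectedComponent.map_mk, hΨ, ConnectedComponent.lift_mk]
      exact hψj x
  have hΦΨ : ∀ C, Φ (Ψ C) = C := by
    intro C
    induction C using ConnectedComponent.ind with
    | h u =>
      simp only [hΨ, ConnectedComponent.lift_mk]
      by_cases h : u ∈ Set.range j
      · obtain ⟨x, rfl⟩ := h
        rw [hψj]
        simp only [hΦ, ConnectedComponent.map_mk]
        rfl
      · rw [hψout u h]
        simp only [hΦ, ConnectedComponent.map_mk, ConnectedComponent.eq]
        show G₂.Reachable (j w₀) u
        refine Adj.reachable ?_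
        rw [sup_adj, wired_adj]
        exact Or.inr ⟨fun h' => h ⟨w₀, h'⟩, (hjW w₀).2 hw₀, hout u h⟩
  exact Nat.card_congr (⟨Ψ, Φ, hΦΨ, hΨΦ⟩ : G₂.ConnectedComponent ≃ G₁.ConnectedComponent)

/-- Reachability in the image of a graph under an injection pulls back: a vertex reachable from
`j x` in `K.map j` is the image of a vertex reachable from `x` in `K`. [folklore] -/
theorem exists_of_reachable_map (K : SimpleGraph V) {x : V} {u : U}
    (h : (K.map j).Reachable (j x) u) : ∃ y, u = j y ∧ K.Reachable x y := by
  obtain ⟨p⟩ := h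
  suffices ∀ {a b : U} (p : (K.map j).Walk a b) (x : V), a = j x → ∃ y, b = j y ∧ K.Reachable x y from
    this p x rfl
  intro a b p
  induction p with
  | nil => intro x hx; exact ⟨x, hx, Reachable.refl _⟩
  | cons hadj _ ih =>
    intro x hx
    rw [SimpleGraph.map_adj] at hadj
    obtain ⟨x', y', hxy', hx', hy'⟩ := hadj
    have : x' = x := j.injective (hx'.trans hx)
    subst this
    obtain ⟨y, hb, hy⟩ := ih y' hy'.symm
    exact ⟨y, hb, hxy'.reachable.trans hy⟩

/-- Reachability pushes forward along the injection. [folklore] -/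
theorem reachable_map_of_reachable (K : SimpleGraph V) {x y : V} (h : K.Reachable x y) :
    (K.map j).Reachable (j x) (j y) := by
  obtain ⟨p⟩ := h
  exact ⟨p.map (SimpleGraph.Embedding.map j K).toHom⟩

end Transport


/-! ### Lattice facts about boxes of `ℤ²` -/

/-- A lattice neighbour of a point of `Λ_n` lies in `Λ_{n+1}`. [folklore] -/
theorem mem_box_succ_of_adj {d n : ℕ} {x y : Site d} (hxy : (zdGraph d).Adj x y) (hx : x ∈ box d n) :
    y ∈ box d (n + 1) := by
  rw [mem_box] at hx ⊢
  rcases (zdGraph_adj_iff x y).1 hxy with ⟨i, rfl | h⟩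
  · intro k
    have := hx k
    by_cases hk : k = i
    · subst hk; simp only [Pi.add_apply, Pi.single_eq_same]; push_cast; omega
    · simp only [Pi.add_apply, Pi.single_eq_of_ne hk, add_zero]; push_cast; omega
  · subst h
    intro k
    have := hx k
    by_cases hk : k = i
    · subst hk; simp only [Pi.add_apply, Pi.single_eq_same] at this; push_cast; omega
    · simp only [Pi.add_apply, Pi.single_eq_of_ne hk, add_zero] at this; push_cast; omega

/-- A point of `Λ_{n+1} ∖ Λ_n` lies on `∂Λ_{n+1}`. [cite: Grimmett2006, §4.2 (∂Λ)] -/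
theorem mem_innerBoundary_box_succ_of_notMem {d n : ℕ} {x : Site d} (hx : x ∈ box d (n + 1))
    (hx' : x ∉ box d n) : x ∈ innerBoundary (zdGraph d) (box d (n + 1)) := by
  rw [mem_box, not_forall] at hx'
  obtain ⟨i, hi⟩ := hx'
  have hxi := (mem_box.1 hx) i
  rcases not_and_or.1 hi with h | h
  · exact mem_innerBoundary_box_of_apply_eq_neg hx i (by push_cast; omega)
  · exact mem_innerBoundary_box_of_apply_eq hx i (by push_cast; omega)

/-- A point of `∂Λ_{n+1}` is not in `Λ_n`. [cite: Grimmett2006, §4.2 (∂Λ)] -/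
theorem notMem_box_of_mem_innerBoundary_succ {d n : ℕ} {x : Site d}
    (hx : x ∈ innerBoundary (zdGraph d) (box d (n + 1))) : x ∉ box d n := by
  rw [mem_innerBoundary_iff] at hx
  obtain ⟨-, y, hy, hxy⟩ := hx
  exact fun h => hy (mem_box_succ_of_adj hxy h)

/-! ### The common vertex type of a lattice domain and a box -/

section Setting

variable {M : Type*} [Fintype M] (ι : M ↪ Site 2) (n : ℕ)

/-- The lattice points of the domain together with those of the box `Λ_{n+1}`. [folklore] -/
def jointFinset : Finset (Site 2) := Finset.univ.map ι ∪ box 2 (n + 1)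

/-- The common vertex type `U`: points of the domain or of the box. [folklore] -/
abbrev JointV : Type := ↥(jointFinset ι n)

/-- The domain inside the common vertex type. [folklore] -/
def jDom : M ↪ JointV ι n :=
  ⟨fun x => ⟨ι x, Finset.mem_union_left _ (Finset.mem_map_of_mem _ (Finset.mem_univ x))⟩,
    fun _ _ h => ι.injective (congrArg Subtype.val h)⟩

/-- The box inside the common vertex type. [folklore] -/
def jBox : BoxV 2 (n + 1) ↪ JointV ι n :=
  ⟨fun y => ⟨y.1, Finset.mem_union_right _ y.2⟩,
    fun _ _ h => Subtype.ext (congrArg (Subtype.val : JointV ι n → Site 2) h)⟩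

/-- The lattice position of a domain vertex in the common type. [folklore] -/
@[simp] theorem jDom_coe (x : M) : (jDom ι n x : Site 2) = ι x := rfl

/-- The lattice position of a box vertex in the common type. [folklore] -/
@[simp] theorem jBox_coe (y : BoxV 2 (n + 1)) : (jBox ι n y : Site 2) = y.1 := rfl

variable (H : SimpleGraph M) [DecidableRel H.Adj]

/-- The domain edges, in the common type. [folklore] -/
def domEdges : Finset (Sym2 (JointV ι n)) := H.edgeFinset.map (jDom ι n).sym2Map

/-- The box edges `E_{Λ_{n+1}}`, in the common type. [folklore] -/
def boxEdges : Finset (Sym2 (JointV ι n)) := (boxGraph 2 (n + 1)).edgeFinset.map (jBox ι n).sym2Map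

/-- The domain edges not inside the box. [folklore] -/
def outEdges : Finset (Sym2 (JointV ι n)) := domEdges ι n H \ boxEdges ι n

/-- The wired set of the box world: every vertex off the open box `Λ_n`. [folklore] -/
def boxWired : Set (JointV ι n) := {u | u.1 ∉ box 2 n}

variable {ι n H}

/-- Membership in the domain edges of the common type. [folklore] -/
theorem mem_domEdges_iff {e : Sym2 (JointV ι n)} :
    e ∈ domEdges ι n H ↔ ∃ e' ∈ H.edgeFinset, (jDom ι n).sym2Map e' = e := by
  rw [domEdges, Finset.mem_map]

/-- Membership in the box edges of the common type. [folklore] -/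
theorem mem_boxEdges_iff {e : Sym2 (JointV ι n)} :
    e ∈ boxEdges ι n ↔ ∃ e' ∈ (boxGraph 2 (n + 1)).edgeFinset, (jBox ι n).sym2Map e' = e := by
  rw [boxEdges, Finset.mem_map]

/-- A pair of box vertices of the common type is a box edge iff the points are lattice
neighbours in the box. [folklore] -/
theorem mk_mem_boxEdges_iff (u w : JointV ι n) :
    s(u, w) ∈ boxEdges ι n ↔ u.1 ∈ box 2 (n + 1) ∧ w.1 ∈ box 2 (n + 1) ∧ (zdGraph 2).Adj u.1 w.1 := by
  rw [mem_boxEdges_iff]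
  constructor
  · rintro ⟨e', he', h⟩
    induction e' using Sym2.ind with
    | h a b =>
      rw [mem_edgeFinset, mem_edgeSet] at he'
      rw [Function.Embedding.sym2Map_apply, Sym2.map_mk, Sym2.eq_iff] at h
      have hab : (zdGraph 2).Adj a.1 b.1 := he'
      rcases h with ⟨rfl, rfl⟩ | ⟨rfl, rfl⟩
      · exact ⟨a.2, b.2, hab⟩
      · exact ⟨b.2, a.2, hab.symm⟩
  · rintro ⟨hu, hw, hadj⟩
    refine ⟨s(⟨u.1, hu⟩, ⟨w.1, hw⟩), ?_, ?_⟩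
    · rw [mem_edgeFinset, mem_edgeSet]; exact hadj
    · rw [Function.Embedding.sym2Map_apply, Sym2.map_mk]
      rfl

variable (hH : ∀ ⦃x y : M⦄, H.Adj x y → (zdGraph 2).Adj (ι x) (ι y))
include hH

omit [DecidableRel H.Adj] in
/-- The image of a domain edge is a box edge iff both endpoints lie in the box. [folklore] -/
theorem sym2Map_mem_boxEdges_iff {x y : M} (hxy : H.Adj x y) :
    (jDom ι n).sym2Map s(x, y) ∈ boxEdges ι n ↔ ι x ∈ box 2 (n + 1) ∧ ι y ∈ box 2 (n + 1) := by
  rw [Function.Embedding.sym2Map_apply, Sym2.map_mk, mk_mem_boxEdges_iff]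
  simp only [jDom_coe]
  exact ⟨fun h => ⟨h.1, h.2.1⟩, fun h => ⟨h.1, h.2, hH hxy⟩⟩

/-- **The domain edges off the box join wired vertices of the box world**: an edge of the domain
that is not a box edge has both endpoints off the open box `Λ_n`. [folklore] -/
theorem fromEdgeSet_outEdges_le :
    fromEdgeSet (↑(outEdges ι n H) : Set (Sym2 (JointV ι n))) ≤ wired (boxWired ι n) := by
  intro u w huw
  rw [fromEdgeSet_adj, Finset.mem_coe, outEdges, Finset.mem_sdiff, mem_domEdges_iff] at huw
  obtain ⟨⟨⟨e', he', heuw⟩, hnot⟩, hne⟩ := huw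
  rw [wired_adj]
  refine ⟨hne, ?_⟩
  induction e' using Sym2.ind with
  | h x y =>
    rw [mem_edgeFinset, mem_edgeSet] at he'
    have key : ι x ∉ box 2 n ∧ ι y ∉ box 2 n := by
      have hb : ¬(ι x ∈ box 2 (n + 1) ∧ ι y ∈ box 2 (n + 1)) := fun h =>
        hnot (heuw ▸ (sym2Map_mem_boxEdges_iff hH he').2 h)
      constructor
      · intro hx
        exact hb ⟨box_mono 2 (Nat.le_succ n) hx, mem_box_succ_of_adj (hH he') hx⟩
      · intro hy
        exact hb ⟨mem_box_succ_of_adj (hH he').symm hy, box_mono 2 (Nat.le_succ n) hy⟩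
    rw [Function.Embedding.sym2Map_apply, Sym2.map_mk, Sym2.eq_iff] at heuw
    rcases heuw with ⟨rfl, rfl⟩ | ⟨rfl, rfl⟩
    · exact key
    · exact ⟨key.2, key.1⟩

end Setting


/-! ### The two weights on the common lattice and Holley's condition -/

section Weights

variable {M : Type*} [Fintype M] (ι : M ↪ Site 2) (n : ℕ) (H : SimpleGraph M) [DecidableRel H.Adj]
  (B : Set M) (p q : ℝ)

/-- Wiring is monotone in the wired set (local copy of the helper of
`FKIsingAnnulusCrossingProofs`, to keep the imports light). [cite: Grimmett2006, §4.2] -/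
private theorem wired_le_wired_of_subset {V : Type*} {S T : Set V} (h : S ⊆ T) : wired S ≤ wired T := by
  intro x y hxy
  rw [wired_adj] at hxy ⊢
  exact ⟨hxy.1, h hxy.2.1, h hxy.2.2⟩

/-- The domain weights transported to the common lattice: the random-cluster weight of the
domain graph (wired on the image of `B`) of a set of domain edges, with the vertices of the box
off the domain as isolated extra vertices; zero off the sets of domain edges.
[cite: Grimmett2006, §1.2, eq. (1.2)] -/
def domWeight (a : Finset (Sym2 (JointV ι n))) : ℝ :=
  if a ⊆ domEdges ι n H then
    p ^ #a * (1 - p) ^ #(domEdges ι n H \ a) *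
      q ^ Nat.card (wiredOpenGraph (↑a : Set (Sym2 (JointV ι n))) (jDom ι n '' B)).ConnectedComponent
  else 0

/-- The box weights coupled with "all domain edges off the box open": the random-cluster weight of
the box `Λ_{n+1}` with everything off the open box `Λ_n` wired, evaluated on `b ∖ E_out`, for the
configurations `b ⊇ E_out` whose remaining edges are box edges; zero otherwise.
[cite: Grimmett2006, §4.2, eqs. (4.11)–(4.12) with ξ = 1] -/
def boxWeight (b : Finset (Sym2 (JointV ι n))) : ℝ :=
  if outEdges ι n H ⊆ b ∧ b \ outEdges ι n H ⊆ boxEdges ι n then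
    p ^ #(b \ outEdges ι n H) * (1 - p) ^ #(boxEdges ι n \ (b \ outEdges ι n H)) *
      q ^ Nat.card (wiredOpenGraph (↑(b \ outEdges ι n H) : Set (Sym2 (JointV ι n)))
        (boxWired ι n)).ConnectedComponent
  else 0

variable {ι n H B p q}

/-- The transported domain weights are nonnegative for `0 ≤ p ≤ 1`, `0 ≤ q`.
[cite: Grimmett2006, §1.2, eq. (1.2)] -/
theorem domWeight_nonneg (hp : p ∈ Set.Icc (0 : ℝ) 1) (hq : 0 ≤ q) (a : Finset (Sym2 (JointV ι n))) :
    0 ≤ domWeight ι n H B p q a := by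
  unfold domWeight
  have h0 : 0 ≤ p := hp.1
  have h1 : 0 ≤ 1 - p := sub_nonneg.2 hp.2
  split_ifs
  · positivity
  · exact le_rfl

/-- The coupled box weights are nonnegative for `0 ≤ p ≤ 1`, `0 ≤ q`.
[cite: Grimmett2006, §1.2, eq. (1.2)] -/
theorem boxWeight_nonneg (hp : p ∈ Set.Icc (0 : ℝ) 1) (hq : 0 ≤ q) (b : Finset (Sym2 (JointV ι n))) :
    0 ≤ boxWeight ι n H p q b := by
  unfold boxWeight
  have h0 : 0 ≤ p := hp.1
  have h1 : 0 ≤ 1 - p := sub_nonneg.2 hp.2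
  split_ifs
  · positivity
  · exact le_rfl

variable (hH : ∀ ⦃x y : M⦄, H.Adj x y → (zdGraph 2).Adj (ι x) (ι y)) (v : M)
  (hB : ∀ b ∈ B, ι b ∉ box 2 n)
include hH hB

/-- **Holley's condition for the pair (domain weights, box weights).** With `a₄ = a ∩ E_box`,
`aₒ = a ∖ E_box ⊆ E_out`, `b₄ = b ∖ E_out`, one has `a ⊓ b = (a₄ ∩ b₄) ∪ aₒ` and
`(a ⊔ b) ∖ E_out = a₄ ∪ b₄`; the exponents of `p` and `1 - p` balance, and the cluster counts
satisfy `k_D(a) + k_□(b₄) ≤ k_D(a ⊓ b) + k_□(a₄ ∪ b₄)` by the mixed supermodularity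
`card_connectedComponent_sup_le_of_le` applied to `(a ⊓ b) ⊔ W_A ≤ b₄ ⊔ W_□` (the domain edges
off the box and the wired set `A` lie inside the wired set of the box world) and `S = a`.
[cite: Grimmett2006, Thm. (3.21) (proof via Holley) and Lemma (4.13)] -/
theorem domWeight_mul_boxWeight_le (hp : p ∈ Set.Icc (0 : ℝ) 1) (hq : 1 ≤ q)
    (a b : Finset (Sym2 (JointV ι n))) :
    domWeight ι n H B p q a * boxWeight ι n H p q b ≤
      domWeight ι n H B p q (a ⊓ b) * boxWeight ι n H p q (a ⊔ b) := by
  have hq0 : 0 ≤ q := zero_le_one.trans hq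
  have h0 : 0 ≤ p := hp.1
  have h1p : 0 ≤ 1 - p := sub_nonneg.2 hp.2
  change domWeight ι n H B p q a * boxWeight ι n H p q b ≤
    domWeight ι n H B p q (a ∩ b) * boxWeight ι n H p q (a ∪ b)
  simp only [domWeight, boxWeight]
  set ED := domEdges ι n H with hED
  set E4 := boxEdges ι n with hE4
  set EO := outEdges ι n H with hEO'
  set WA : Set (JointV ι n) := jDom ι n '' B with hWA
  set W4 : Set (JointV ι n) := boxWired ι n with hW4
  have hEO : EO = ED \ E4 := rfl
  have hnn : ∀ (c : Prop) [Decidable c] (x y : ℕ) (z : ℕ),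
      0 ≤ (if c then p ^ x * (1 - p) ^ y * q ^ z else 0) := by
    intro c _ x y z
    split_ifs
    · positivity
    · exact le_rfl
  by_cases ha : a ⊆ ED
  swap
  · rw [if_neg ha, zero_mul]
    exact mul_nonneg (hnn _ _ _ _) (hnn _ _ _ _)
  by_cases hb : EO ⊆ b ∧ b \ EO ⊆ E4
  swap
  · rw [if_neg hb, mul_zero]
    exact mul_nonneg (hnn _ _ _ _) (hnn _ _ _ _)
  -- notation
  set a₄ := a ∩ E4 with ha₄
  set aₒ := a \ E4 with haₒ
  set b₄ := b \ EO with hb₄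
  have haₒEO : aₒ ⊆ EO := fun e he => by
    rw [hEO, Finset.mem_sdiff]; exact ⟨ha (Finset.mem_sdiff.1 he).1, (Finset.mem_sdiff.1 he).2⟩
  have hb₄E4 : b₄ ⊆ E4 := hb.2
  have hEOE4 : Disjoint EO E4 := by rw [hEO]; exact Finset.sdiff_disjoint
  -- the two set identities
  have h1 : (a ∪ b) \ EO = a₄ ∪ b₄ := by
    ext e
    simp only [Finset.mem_sdiff, Finset.mem_union, ha₄, hb₄, Finset.mem_inter]
    constructor
    · rintro ⟨hab | hbb, hne⟩
      · left
        refine ⟨hab, ?_⟩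
        by_contra he4
        exact hne (by rw [hEO, Finset.mem_sdiff]; exact ⟨ha hab, he4⟩)
      · exact Or.inr ⟨hbb, hne⟩
    · rintro (⟨hea, he4⟩ | ⟨heb, hne⟩)
      · exact ⟨Or.inl hea, fun heO => Finset.disjoint_left.1 hEOE4 heO he4⟩
      · exact ⟨Or.inr heb, hne⟩
  have h2 : a ∩ b = (a₄ ∩ b₄) ∪ aₒ := by
    ext e
    simp only [Finset.mem_inter, Finset.mem_union, ha₄, hb₄, haₒ, Finset.mem_sdiff]
    constructor
    · rintro ⟨hea, heb⟩
      by_cases he4 : e ∈ E4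
      · exact Or.inl ⟨⟨hea, he4⟩, heb, fun heO => Finset.disjoint_left.1 hEOE4 heO he4⟩
      · exact Or.inr ⟨hea, he4⟩
    · rintro (⟨⟨hea, -⟩, heb, -⟩ | ⟨hea, he4⟩)
      · exact ⟨hea, heb⟩
      · exact ⟨hea, hb.1 (haₒEO (Finset.mem_sdiff.2 ⟨hea, he4⟩))⟩
  have hdisj : Disjoint (a₄ ∩ b₄) aₒ := by
    rw [Finset.disjoint_left]
    rintro e he he'
    exact (Finset.mem_sdiff.1 he').2 (Finset.mem_inter.1 (Finset.mem_inter.1 he).1).2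
  have hlive : EO ⊆ a ∪ b ∧ (a ∪ b) \ EO ⊆ E4 := by
    refine ⟨hb.1.trans Finset.subset_union_right, ?_⟩
    rw [h1]
    exact Finset.union_subset Finset.inter_subset_right hb₄E4
  have hab : a ∩ b ⊆ ED := Finset.inter_subset_left.trans ha
  -- cardinalities
  have hc1 : #a + #b₄ = #(a ∩ b) + #(a₄ ∪ b₄) := by
    have e1 : #(a ∩ b) = #(a₄ ∩ b₄) + #aₒ := by rw [h2, Finset.card_union_of_disjoint hdisj]
    have e2 : #(a₄ ∪ b₄) + #(a₄ ∩ b₄) = #a₄ + #b₄ := Finset.card_union_add_card_inter _ _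
    have e3 : #aₒ + #a₄ = #a := by rw [haₒ, ha₄, Finset.card_sdiff_add_card_inter]
    omega
  have hc2 : #(ED \ a) + #(E4 \ b₄) = #(ED \ (a ∩ b)) + #(E4 \ (a₄ ∪ b₄)) := by
    have e1 : #(ED \ a) = #ED - #a := Finset.card_sdiff_of_subset ha
    have e2 : #(ED \ (a ∩ b)) = #ED - #(a ∩ b) := Finset.card_sdiff_of_subset hab
    have e3 : #(E4 \ b₄) = #E4 - #b₄ := Finset.card_sdiff_of_subset hb₄E4
    have h44 : a₄ ∪ b₄ ⊆ E4 := Finset.union_subset Finset.inter_subset_right hb₄E4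
    have e4 : #(E4 \ (a₄ ∪ b₄)) = #E4 - #(a₄ ∪ b₄) := Finset.card_sdiff_of_subset h44
    have l1 := Finset.card_le_card ha
    have l2 := Finset.card_le_card hab
    have l3 := Finset.card_le_card hb₄E4
    have l4 := Finset.card_le_card h44
    omega
  -- cluster counts
  have hWAW4 : WA ⊆ W4 := by
    rintro _ ⟨x, hx, rfl⟩
    exact hB x hx
  have haa : a = a₄ ∪ aₒ := by rw [ha₄, haₒ]; exact (sup_inf_sdiff a E4).symm
  have haₒW4 : fromEdgeSet (↑aₒ : Set (Sym2 (JointV ι n))) ≤ wired W4 :=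
    (fromEdgeSet_mono (Finset.coe_subset.2 haₒEO)).trans (fromEdgeSet_outEdges_le hH)
  have hle : wiredOpenGraph (↑(a ∩ b) : Set (Sym2 (JointV ι n))) WA ≤
      wiredOpenGraph (↑b₄ : Set (Sym2 (JointV ι n))) W4 := by
    change fromEdgeSet ↑(a ∩ b) ⊔ wired WA ≤ fromEdgeSet ↑b₄ ⊔ wired W4
    rw [h2, Finset.coe_union, fromEdgeSet_union]
    refine sup_le (sup_le ?_ (haₒW4.trans le_sup_right)) ((wired_le_wired_of_subset hWAW4).trans le_sup_right)
    exact (fromEdgeSet_mono (Finset.coe_subset.2 Finset.inter_subset_right)).trans le_sup_left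
  have hG₀S : wiredOpenGraph (↑(a ∩ b) : Set (Sym2 (JointV ι n))) WA ⊔ fromEdgeSet ↑a =
      wiredOpenGraph (↑a : Set (Sym2 (JointV ι n))) WA := by
    change fromEdgeSet ↑(a ∩ b) ⊔ wired WA ⊔ fromEdgeSet ↑a = fromEdgeSet ↑a ⊔ wired WA
    rw [sup_right_comm,
      sup_eq_right.2 (fromEdgeSet_mono (Finset.coe_subset.2 Finset.inter_subset_left))]
  have hG'S : wiredOpenGraph (↑b₄ : Set (Sym2 (JointV ι n))) W4 ⊔ fromEdgeSet ↑a =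
      wiredOpenGraph (↑(a₄ ∪ b₄) : Set (Sym2 (JointV ι n))) W4 := by
    change fromEdgeSet ↑b₄ ⊔ wired W4 ⊔ fromEdgeSet ↑a = fromEdgeSet ↑(a₄ ∪ b₄) ⊔ wired W4
    conv_lhs => rw [haa]
    rw [Finset.coe_union, fromEdgeSet_union, Finset.coe_union, fromEdgeSet_union]
    refine le_antisymm ?_ ?_
    · refine sup_le (sup_le ?_ le_sup_right) (sup_le ?_ (haₒW4.trans le_sup_right))
      · exact le_sup_right.trans le_sup_left
      · exact le_sup_left.trans le_sup_left
    · refine sup_le (sup_le ?_ ?_) (le_sup_right.trans le_sup_left)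
      · exact le_sup_left.trans le_sup_right
      · exact le_sup_left.trans le_sup_left
  have hk := card_connectedComponent_sup_le_of_le (fromEdgeSet (↑a : Set (Sym2 (JointV ι n)))) hle
  rw [hG₀S, hG'S] at hk
  -- assemble
  rw [if_pos ha, if_pos hab, if_pos hb, if_pos hlive, h1]
  suffices key : ∀ kDa kDab k4b k4ab : ℕ, kDa + k4b ≤ kDab + k4ab →
      p ^ #a * (1 - p) ^ #(ED \ a) * q ^ kDa * (p ^ #b₄ * (1 - p) ^ #(E4 \ b₄) * q ^ k4b) ≤
        p ^ #(a ∩ b) * (1 - p) ^ #(ED \ (a ∩ b)) * q ^ kDab *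
          (p ^ #(a₄ ∪ b₄) * (1 - p) ^ #(E4 \ (a₄ ∪ b₄)) * q ^ k4ab) from
    key _ _ _ _ hk
  intro kDa kDab k4b k4ab hk'
  have hqk : q ^ (kDa + k4b) ≤ q ^ (kDab + k4ab) := pow_le_pow_right₀ hq hk'
  calc p ^ #a * (1 - p) ^ #(ED \ a) * q ^ kDa * (p ^ #b₄ * (1 - p) ^ #(E4 \ b₄) * q ^ k4b)
      = p ^ (#a + #b₄) * (1 - p) ^ (#(ED \ a) + #(E4 \ b₄)) * q ^ (kDa + k4b) := by
        rw [pow_add, pow_add, pow_add]; ring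
    _ ≤ p ^ (#a + #b₄) * (1 - p) ^ (#(ED \ a) + #(E4 \ b₄)) * q ^ (kDab + k4ab) :=
        mul_le_mul_of_nonneg_left hqk (mul_nonneg (pow_nonneg h0 _) (pow_nonneg h1p _))
    _ = p ^ #(a ∩ b) * (1 - p) ^ #(ED \ (a ∩ b)) * q ^ kDab *
          (p ^ #(a₄ ∪ b₄) * (1 - p) ^ #(E4 \ (a₄ ∪ b₄)) * q ^ k4ab) := by
        rw [hc1, hc2, pow_add, pow_add, pow_add]; ring

end Weights


/-! ### The two sums as random-cluster measures, and the comparison -/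

section Comparison

variable {M : Type*} [Fintype M] [DecidableEq M] {ι : M ↪ Site 2} {n : ℕ} {H : SimpleGraph M}
  [DecidableRel H.Adj] {B : Set M} {p q : ℝ}

/-- The open graph of an image configuration is the image graph. [folklore] -/
theorem fromEdgeSet_image_eq_map {V U : Type*} (j : V ↪ U) (ω : Set (Sym2 V)) :
    fromEdgeSet (Sym2.map j '' ω) = (fromEdgeSet ω).map j := by
  ext u w
  rw [fromEdgeSet_adj, SimpleGraph.map_adj]
  constructor
  · rintro ⟨⟨e, he, heuw⟩, hne⟩
    induction e using Sym2.ind with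
    | h x y =>
      rw [Sym2.map_mk, Sym2.eq_iff] at heuw
      rcases heuw with ⟨rfl, rfl⟩ | ⟨rfl, rfl⟩
      · exact ⟨x, y, (fromEdgeSet_adj _).2 ⟨he, fun h => hne (congrArg j h)⟩, rfl, rfl⟩
      · refine ⟨y, x, (fromEdgeSet_adj _).2 ⟨Sym2.eq_swap ▸ he, fun h => hne (congrArg j h)⟩, rfl, rfl⟩
  · rintro ⟨x, y, hxy, rfl, rfl⟩
    rw [fromEdgeSet_adj] at hxy
    exact ⟨⟨s(x, y), hxy.1, Sym2.map_mk _ _ _⟩, fun h => hxy.2 (j.injective h)⟩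

omit [DecidableEq M] in
/-- The sets of domain edges of the common lattice are the images of the edge sets of the
domain. [folklore] -/
theorem filter_subset_domEdges_eq :
    (Finset.univ.filter fun a : Finset (Sym2 (JointV ι n)) => a ⊆ domEdges ι n H) =
      H.edgeFinset.powerset.map ⟨fun ω => ω.map (jDom ι n).sym2Map, Finset.map_injective _⟩ := by
  ext a
  simp only [Finset.mem_filter, Finset.mem_univ, true_and, Finset.mem_map, Finset.mem_powerset,
    Function.Embedding.coeFn_mk]
  constructor
  · intro ha
    obtain ⟨u, hu, rfl⟩ := Finset.subset_map_iff.1 ha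
    exact ⟨u, hu, rfl⟩
  · rintro ⟨ω, hω, rfl⟩
    exact Finset.map_subset_map.2 hω

/-- **The domain side of the comparison.** Summing a function against the transported domain
weights is `q^{#extra vertices}` times summing it against the random-cluster weights of the
domain. [cite: Grimmett2006, §1.2, eq. (1.2)] -/
theorem sum_mul_domWeight (F : Finset (Sym2 (JointV ι n)) → ℝ) :
    ∑ a, F a * domWeight ι n H B p q a =
      q ^ Nat.card {u : JointV ι n // u ∉ Set.range (jDom ι n)} *
        ∑ ω ∈ H.edgeFinset.powerset, F (ω.map (jDom ι n).sym2Map) * rcWeight H p q B ω := by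
  have step1 : ∑ a, F a * domWeight ι n H B p q a =
      ∑ a ∈ Finset.univ.filter (fun a : Finset (Sym2 (JointV ι n)) => a ⊆ domEdges ι n H),
        F a * domWeight ι n H B p q a := by
    rw [Finset.sum_filter]
    refine Finset.sum_congr rfl fun a _ => ?_
    by_cases ha : a ⊆ domEdges ι n H
    · rw [if_pos ha]
    · rw [if_neg ha, domWeight, if_neg ha, mul_zero]
  rw [step1, filter_subset_domEdges_eq, Finset.sum_map, Finset.mul_sum]
  refine Finset.sum_congr rfl fun ω hω => ?_
  rw [Finset.mem_powerset] at hω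
  simp only [Function.Embedding.coeFn_mk]
  have hsub : ω.map (jDom ι n).sym2Map ⊆ domEdges ι n H := Finset.map_subset_map.2 hω
  rw [domWeight, if_pos hsub, rcWeight]
  -- the three factors
  have e1 : #(ω.map (jDom ι n).sym2Map) = #ω := Finset.card_map _
  have e2 : #(domEdges ι n H \ ω.map (jDom ι n).sym2Map) = #(H.edgeFinset \ ω) := by
    rw [Finset.card_sdiff_of_subset hsub, Finset.card_sdiff_of_subset hω, domEdges,
      Finset.card_map, Finset.card_map]
  have e3 : Nat.card (wiredOpenGraph (↑(ω.map (jDom ι n).sym2Map) : Set (Sym2 (JointV ι n)))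
        (jDom ι n '' B)).ConnectedComponent =
      clusterCount (↑ω : Percolation.BondConfig M) B +
        Nat.card {u : JointV ι n // u ∉ Set.range (jDom ι n)} := by
    have hcoe : (↑(ω.map (jDom ι n).sym2Map) : Set (Sym2 (JointV ι n))) =
        Sym2.map (jDom ι n) '' (↑ω : Set (Sym2 M)) := by
      rw [Finset.coe_map]; rfl
    rw [hcoe, card_connectedComponent_image_eq_add]
    rfl
  rw [e1, e2, e3, pow_add]
  ring

variable (ι n) in
/-- The arm event in the common lattice: the image of `v` is joined to a vertex of `∂Λ_{n+1}`
through configuration edges that are box edges. [cite: Grimmett2006, Prop. (5.11) ({0 ↔ ∂Λ})] -/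
def jointArm (v : M) (b : Finset (Sym2 (JointV ι n))) : Prop :=
  ∃ s : JointV ι n, s.1 ∈ innerBoundary (zdGraph 2) (box 2 (n + 1)) ∧
    (fromEdgeSet (↑(b ∩ boxEdges ι n) : Set (Sym2 (JointV ι n)))).Reachable (jDom ι n v) s

omit [DecidableEq M] [DecidableRel H.Adj] in
/-- The arm event of the common lattice is increasing. [cite: Grimmett2006, §2.1 (increasing events)] -/
theorem jointArm_mono (v : M) {b b' : Finset (Sym2 (JointV ι n))} (hbb : b ⊆ b') (hb : jointArm ι n v b) :
    jointArm ι n v b' := by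
  obtain ⟨s, hs, hreach⟩ := hb
  exact ⟨s, hs, hreach.mono (fromEdgeSet_mono (Finset.coe_subset.2
    (Finset.inter_subset_inter_right hbb)))⟩


omit [DecidableEq M] in
/-- The live configurations of the box world are `ξ ∪ E_out` for the edge sets `ξ` of the box.
[folklore] -/
theorem boxWeight_live_iff (b : Finset (Sym2 (JointV ι n))) :
    (outEdges ι n H ⊆ b ∧ b \ outEdges ι n H ⊆ boxEdges ι n) ↔
      ∃ ξ ⊆ (boxGraph 2 (n + 1)).edgeFinset, ξ.map (jBox ι n).sym2Map ∪ outEdges ι n H = b := by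
  constructor
  · rintro ⟨h1, h2⟩
    obtain ⟨ξ, hξ, hb⟩ := Finset.subset_map_iff.1 h2
    refine ⟨ξ, hξ, ?_⟩
    rw [← hb]
    exact Finset.sdiff_union_of_subset h1
  · rintro ⟨ξ, hξ, rfl⟩
    refine ⟨Finset.subset_union_right, ?_⟩
    rw [Finset.union_sdiff_self]
    exact Finset.sdiff_subset.trans (Finset.map_subset_map.2 hξ)

omit [DecidableEq M] in
/-- A mapped box configuration avoids the domain edges off the box. [folklore] -/
theorem disjoint_map_outEdges (ξ : Finset (Sym2 (BoxV 2 (n + 1))))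
    (hξ : ξ ⊆ (boxGraph 2 (n + 1)).edgeFinset) :
    Disjoint (ξ.map (jBox ι n).sym2Map) (outEdges ι n H) :=
  Finset.disjoint_of_subset_left (Finset.map_subset_map.2 hξ) Finset.disjoint_sdiff

omit [DecidableEq M] in
/-- The wired set of the box world is exactly "every box preimage lies on `∂Λ_{n+1}`".
[cite: Grimmett2006, §4.2 (∂Λ)] -/
theorem mem_boxWired_iff (u : JointV ι n) :
    u ∈ boxWired ι n ↔ ∀ y : BoxV 2 (n + 1), jBox ι n y = u → y ∈ boxBoundary 2 (n + 1) := by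
  constructor
  · intro hu y hy
    have hyu : y.1 = u.1 := congrArg Subtype.val hy
    show y.1 ∈ innerBoundary (zdGraph 2) (box 2 (n + 1))
    rw [hyu]
    exact mem_innerBoundary_box_succ_of_notMem (hyu ▸ y.2) hu
  · intro h hu
    have hu' : u.1 ∈ box 2 (n + 1) := box_mono 2 (Nat.le_succ n) hu
    have := h ⟨u.1, hu'⟩ (Subtype.ext rfl)
    exact notMem_box_of_mem_innerBoundary_succ this hu

omit [DecidableEq M] in
/-- **The box side of the comparison.** Summing a function against the coupled box weights is
summing it against the wired random-cluster weights of the box `Λ_{n+1}`.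
[cite: Grimmett2006, §4.2, eqs. (4.11)–(4.12) with ξ = 1] -/
theorem sum_mul_boxWeight (F : Finset (Sym2 (JointV ι n)) → ℝ) :
    ∑ b, F b * boxWeight ι n H p q b =
      ∑ ξ ∈ (boxGraph 2 (n + 1)).edgeFinset.powerset,
        F (ξ.map (jBox ι n).sym2Map ∪ outEdges ι n H) *
          rcWeight (boxGraph 2 (n + 1)) p q (boxBoundary 2 (n + 1)) ξ := by
  classical
  set live : Finset (Sym2 (JointV ι n)) → Prop :=
    fun b => outEdges ι n H ⊆ b ∧ b \ outEdges ι n H ⊆ boxEdges ι n with hlive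
  have step1 : ∑ b, F b * boxWeight ι n H p q b =
      ∑ b ∈ Finset.univ.filter live, F b * boxWeight ι n H p q b := by
    rw [Finset.sum_filter]
    refine Finset.sum_congr rfl fun b _ => ?_
    by_cases hb : live b
    · rw [if_pos hb]
    · rw [if_neg hb, boxWeight, if_neg hb, mul_zero]
  rw [step1]
  symm
  refine Finset.sum_nbij (fun ξ => ξ.map (jBox ι n).sym2Map ∪ outEdges ι n H) ?_ ?_ ?_ ?_
  · intro ξ hξ
    rw [Finset.mem_powerset] at hξ
    rw [Finset.mem_filter]
    exact ⟨Finset.mem_univ _, (boxWeight_live_iff _).2 ⟨ξ, hξ, rfl⟩⟩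
  · intro ξ hξ ξ' hξ' h
    rw [Finset.mem_coe, Finset.mem_powerset] at hξ hξ'
    have h1 := congrArg (fun b => b \ outEdges ι n H) h
    simp only at h1
    rw [Finset.union_sdiff_cancel_right (disjoint_map_outEdges ξ hξ),
      Finset.union_sdiff_cancel_right (disjoint_map_outEdges ξ' hξ')] at h1
    exact Finset.map_injective _ h1
  · intro b hb
    rw [Finset.mem_coe, Finset.mem_filter] at hb
    obtain ⟨ξ, hξ, rfl⟩ := (boxWeight_live_iff _).1 hb.2
    exact ⟨ξ, Finset.mem_powerset.2 hξ, rfl⟩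
  · intro ξ hξ
    rw [Finset.mem_powerset] at hξ
    have hl : live (ξ.map (jBox ι n).sym2Map ∪ outEdges ι n H) :=
      (boxWeight_live_iff _).2 ⟨ξ, hξ, rfl⟩
    have hsd : (ξ.map (jBox ι n).sym2Map ∪ outEdges ι n H) \ outEdges ι n H =
        ξ.map (jBox ι n).sym2Map :=
      Finset.union_sdiff_cancel_right (disjoint_map_outEdges ξ hξ)
    rw [boxWeight, if_pos hl, hsd, rcWeight]
    have e1 : #(ξ.map (jBox ι n).sym2Map) = #ξ := Finset.card_map _
    have e2 : #(boxEdges ι n \ ξ.map (jBox ι n).sym2Map) = #((boxGraph 2 (n + 1)).edgeFinset \ ξ) := by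
      rw [boxEdges, Finset.card_sdiff_of_subset (Finset.map_subset_map.2 hξ), Finset.card_map,
        Finset.card_sdiff_of_subset hξ, Finset.card_map]
    have e3 : Nat.card (wiredOpenGraph (↑(ξ.map (jBox ι n).sym2Map) : Set (Sym2 (JointV ι n)))
          (boxWired ι n)).ConnectedComponent =
        clusterCount (↑ξ : Percolation.BondConfig (BoxV 2 (n + 1))) (boxBoundary 2 (n + 1)) := by
      have hcoe : (↑(ξ.map (jBox ι n).sym2Map) : Set (Sym2 (JointV ι n))) =
          Sym2.map (jBox ι n) '' (↑ξ : Set (Sym2 (BoxV 2 (n + 1)))) := by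
        rw [Finset.coe_map]; rfl
      have hW : (boxBoundary 2 (n + 1)).Nonempty := by
        obtain ⟨x, hx⟩ := innerBoundary_box_nonempty (d := 2) two_pos (n + 1)
        exact ⟨⟨x, (mem_innerBoundary_iff.1 hx).1⟩, hx⟩
      rw [hcoe, card_connectedComponent_image_eq (jBox ι n) _ hW (mem_boxWired_iff)]
      rfl
    rw [e1, e2, e3]

omit [DecidableEq M] in
/-- The arm event read on a transported domain configuration is the arm event of the domain
(centred form: `ι v = 0`). [folklore] -/
theorem jointArm_map_iff (hH : ∀ ⦃x y : M⦄, H.Adj x y → (zdGraph 2).Adj (ι x) (ι y)) (v : M)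
    {ω : Finset (Sym2 M)} (hω : ω ⊆ H.edgeFinset) :
    jointArm ι n v (ω.map (jDom ι n).sym2Map) ↔
      ∃ s : M, ι s ∈ innerBoundary (zdGraph 2) (box 2 (n + 1)) ∧
        (fromEdgeSet {e | e ∈ (↑ω : Set (Sym2 M)) ∧ ∀ x ∈ e, ι x ∈ box 2 (n + 1)}).Reachable v s := by
  -- the box part of the transported configuration is the image of the box part
  have key : (↑(ω.map (jDom ι n).sym2Map ∩ boxEdges ι n) : Set (Sym2 (JointV ι n))) =
      Sym2.map (jDom ι n) '' {e | e ∈ (↑ω : Set (Sym2 M)) ∧ ∀ x ∈ e, ι x ∈ box 2 (n + 1)} := by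
    ext e
    rw [Finset.coe_inter, Set.mem_inter_iff, Finset.mem_coe, Finset.mem_coe, Finset.mem_map]
    constructor
    · rintro ⟨⟨e', he', rfl⟩, h4⟩
      refine ⟨e', ⟨he', ?_⟩, rfl⟩
      induction e' using Sym2.ind with
      | h x y =>
        have hadj : H.Adj x y := by
          have := hω he'; rwa [mem_edgeFinset, mem_edgeSet] at this
        have hb := (sym2Map_mem_boxEdges_iff hH hadj).1 h4
        intro z hz
        rcases Sym2.mem_iff.1 hz with rfl | rfl
        · exact hb.1
        · exact hb.2
    · rintro ⟨e', ⟨he', hbox⟩, rfl⟩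
      refine ⟨⟨e', he', rfl⟩, ?_⟩
      induction e' using Sym2.ind with
      | h x y =>
        have hadj : H.Adj x y := by
          have := hω he'; rwa [mem_edgeFinset, mem_edgeSet] at this
        exact (sym2Map_mem_boxEdges_iff hH hadj).2
          ⟨hbox x (Sym2.mem_mk_left _ _), hbox y (Sym2.mem_mk_right _ _)⟩
  unfold jointArm
  rw [key, fromEdgeSet_image_eq_map]
  constructor
  · rintro ⟨s, hs, hreach⟩
    obtain ⟨y, rfl, hy⟩ := exists_of_reachable_map (jDom ι n) _ hreach
    exact ⟨y, hs, hy⟩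
  · rintro ⟨s, hs, hreach⟩
    exact ⟨jDom ι n s, hs, reachable_map_of_reachable (jDom ι n) _ hreach⟩

omit [DecidableEq M] in
/-- The arm event read on a coupled box configuration is `{0 ↔ ∂Λ_{n+1}}` (centred form:
`ι v = 0`). [cite: Grimmett2006, Prop. (5.11) ({0 ↔ ∂Λ})] -/
theorem jointArm_box_iff {v : M}
    (h0 : ι v = 0) {ξ : Finset (Sym2 (BoxV 2 (n + 1)))} (hξ : ξ ⊆ (boxGraph 2 (n + 1)).edgeFinset) :
    jointArm ι n v (ξ.map (jBox ι n).sym2Map ∪ outEdges ι n H) ↔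
      ∃ y : BoxV 2 (n + 1), y ∈ boxBoundary 2 (n + 1) ∧
        (Percolation.openGraph (↑ξ : Set (Sym2 (BoxV 2 (n + 1))))).Reachable (boxOrigin 2 (n + 1)) y := by
  have key : (ξ.map (jBox ι n).sym2Map ∪ outEdges ι n H) ∩ boxEdges ι n = ξ.map (jBox ι n).sym2Map := by
    have hsub : ξ.map (jBox ι n).sym2Map ⊆ boxEdges ι n := Finset.map_subset_map.2 hξ
    have : outEdges ι n H ∩ boxEdges ι n = ∅ :=
      Finset.disjoint_iff_inter_eq_empty.1 Finset.sdiff_disjoint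
    rw [Finset.union_inter_distrib_right, Finset.inter_eq_left.2 hsub, this, Finset.union_empty]
  have hcoe : (↑(ξ.map (jBox ι n).sym2Map) : Set (Sym2 (JointV ι n))) =
      Sym2.map (jBox ι n) '' (↑ξ : Set (Sym2 (BoxV 2 (n + 1)))) := by
    rw [Finset.coe_map]; rfl
  have hv : jDom ι n v = jBox ι n (boxOrigin 2 (n + 1)) := Subtype.ext h0
  unfold jointArm
  rw [key, hcoe, fromEdgeSet_image_eq_map, hv]
  constructor
  · rintro ⟨s, hs, hreach⟩
    obtain ⟨y, rfl, hy⟩ := exists_of_reachable_map (jBox ι n) _ hreach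
    exact ⟨y, hs, hy⟩
  · rintro ⟨y, hy, hreach⟩
    exact ⟨jBox ι n y, hy, reachable_map_of_reachable (jBox ι n) _ hreach⟩

variable (ι n) in
/-- The arm event of the domain, centred form: `v` is joined to a vertex whose lattice position lies
on `∂Λ_{n+1}` through open edges whose endpoints have lattice positions in `Λ_{n+1}`.
[cite: Smirnov2010, Appendix A, proof of Lemma A.1 ("B connected to ∂Q inside Ω")] -/
def domainArmEvent₀ (v : M) : Set (Percolation.BondConfig M) :=
  {ω | ∃ s : M, ι s ∈ innerBoundary (zdGraph 2) (box 2 (n + 1)) ∧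
    (fromEdgeSet {e | e ∈ ω ∧ ∀ x ∈ e, ι x ∈ box 2 (n + 1)}).Reachable v s}

/-- **Comparison between a lattice domain and the wired box (centred form).** For a finite graph
`H` embedded in `ℤ²` by `ι` (edges go to lattice edges), any wired set `B` whose points avoid the
open box `Λ_n` around `ι v = 0`, `0 ≤ p ≤ 1` and `q ≥ 1`: the `φ^B_{H,p,q}`-probability that `v` is
joined to `∂Λ_{n+1}` inside `Λ_{n+1}` is at most `φ¹_{Λ_{n+1},p,q}(0 ↔ ∂Λ_{n+1})`. This is the chain
"`≤ P(B ↔ ∂Q inside Ω, everything outside Q wired) ≤ P(B ↔ ∂Q inside Q, ∂Q wired)`" of the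
printed proof, obtained here from a single application of Holley's inequality (Mathlib `holley`)
to the pair (domain weights, box weights coupled with "domain edges off the box open") on the
common lattice of edge sets, whose Holley condition is `domWeight_mul_boxWeight_le`.
[cite: Smirnov2010, Appendix A, proof of Lemma A.1; Grimmett2006, Lemma (4.13), Thm. (3.21)] -/
theorem rcMeasure_real_domainArmEvent₀_le
    (hH : ∀ ⦃x y : M⦄, H.Adj x y → (zdGraph 2).Adj (ι x) (ι y)) {v : M} (h0 : ι v = 0)
    (hB : ∀ b ∈ B, ι b ∉ box 2 n) (hp : p ∈ Set.Icc (0 : ℝ) 1) (hq : 1 ≤ q) :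
    (rcMeasure H p q B).real (domainArmEvent₀ ι n v) ≤ thetaWiredBox 2 p q (n + 1) := by
  classical
  have hq0 : 0 < q := one_pos.trans_le hq
  set ZH := rcPartitionFunction H p q B with hZH
  set Zb := rcPartitionFunction (boxGraph 2 (n + 1)) p q (boxBoundary 2 (n + 1)) with hZb
  have hZH0 : 0 < ZH := rcPartitionFunction_pos H hp hq0 B
  have hZb0 : 0 < Zb := rcPartitionFunction_pos _ hp hq0 _
  set c := Nat.card {u : JointV ι n // u ∉ Set.range (jDom ι n)} with hc
  have hqc : 0 < q ^ c := pow_pos hq0 c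
  -- Holley's data
  set μ : Finset (Sym2 (JointV ι n)) → ℝ := fun b => if jointArm ι n v b then 1 else 0 with hμ
  set f : Finset (Sym2 (JointV ι n)) → ℝ := fun a => domWeight ι n H B p q a / (q ^ c * ZH) with hf
  set g : Finset (Sym2 (JointV ι n)) → ℝ := fun b => boxWeight ι n H p q b / Zb with hg
  have hμ0 : 0 ≤ μ := fun b => by simp only [hμ, Pi.zero_apply]; split_ifs <;> norm_num
  have hf0 : 0 ≤ f := fun a => div_nonneg (domWeight_nonneg hp hq0.le a) (mul_pos hqc hZH0).le
  have hg0 : 0 ≤ g := fun b => div_nonneg (boxWeight_nonneg hp hq0.le b) hZb0.le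
  have hμm : Monotone μ := by
    intro b b' hbb
    simp only [hμ]
    by_cases hb : jointArm ι n v b
    · rw [if_pos hb, if_pos (jointArm_mono v hbb hb)]
    · rw [if_neg hb]; split_ifs <;> norm_num
  have hsumf : ∑ a, f a = 1 := by
    have h1 := sum_mul_domWeight (ι := ι) (n := n) (H := H) (B := B) (p := p) (q := q) (fun _ => 1)
    simp only [one_mul] at h1
    rw [hf]
    simp only
    rw [← Finset.sum_div, h1, ← hc, ← rcPartitionFunction, ← hZH, div_self (mul_pos hqc hZH0).ne']
  have hsumg : ∑ b, g b = 1 := by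
    have h1 := sum_mul_boxWeight (ι := ι) (n := n) (H := H) (p := p) (q := q) (fun _ => (1 : ℝ))
    simp only [one_mul] at h1
    rw [hg]
    simp only
    rw [← Finset.sum_div, h1, ← rcPartitionFunction, ← hZb, div_self hZb0.ne']
  have hcond : ∀ a b, f a * g b ≤ f (a ⊓ b) * g (a ⊔ b) := by
    intro a b
    simp only [hf, hg]
    rw [div_mul_div_comm, div_mul_div_comm]
    exact div_le_div_of_nonneg_right (domWeight_mul_boxWeight_le hH hB hp hq a b)
      (mul_pos (mul_pos hqc hZH0) hZb0).le
  have key := holley f g μ hμ0 hf0 hg0 hμm (hsumf.trans hsumg.symm) hcond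
  -- identify the two sides
  have hL : ∑ a, μ a * f a = (rcMeasure H p q B).real (domainArmEvent₀ ι n v) := by
    rw [rcMeasure_real_eq_sum_div H hp hq0 B]
    have e1 : ∑ a, μ a * f a = (∑ a, μ a * domWeight ι n H B p q a) / (q ^ c * ZH) := by
      rw [Finset.sum_div]
      exact Finset.sum_congr rfl fun a _ => (mul_div_assoc _ _ _).symm
    have e2 : ∑ a, μ a * domWeight ι n H B p q a =
        q ^ c * ∑ ω ∈ H.edgeFinset.powerset, μ (ω.map (jDom ι n).sym2Map) * rcWeight H p q B ω :=
      sum_mul_domWeight μ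
    rw [e1, e2, mul_div_mul_left _ _ hqc.ne']
    refine congrArg₂ (· / ·) ?_ rfl
    refine Finset.sum_congr rfl fun ω hω => ?_
    rw [Finset.mem_powerset] at hω
    have hiff := jointArm_map_iff (n := n) hH v hω
    by_cases hA : (↑ω : Percolation.BondConfig M) ∈ domainArmEvent₀ ι n v
    · have hj : jointArm ι n v (ω.map (jDom ι n).sym2Map) := hiff.2 hA
      rw [if_pos hA]
      simp only [hμ, hj, if_true, one_mul]
    · have hj : ¬ jointArm ι n v (ω.map (jDom ι n).sym2Map) := fun h => hA (hiff.1 h)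
      rw [if_neg hA]
      simp only [hμ, hj, if_false, zero_mul]
  have hR : ∑ b, μ b * g b = thetaWiredBox 2 p q (n + 1) := by
    rw [thetaWiredBox, rcMeasure_real_eq_sum_div _ hp hq0]
    have e1 : ∑ b, μ b * g b = (∑ b, μ b * boxWeight ι n H p q b) / Zb := by
      rw [Finset.sum_div]
      exact Finset.sum_congr rfl fun b _ => (mul_div_assoc _ _ _).symm
    rw [e1, sum_mul_boxWeight μ]
    refine congrArg₂ (· / ·) ?_ rfl
    refine Finset.sum_congr rfl fun ξ hξ => ?_
    rw [Finset.mem_powerset] at hξ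
    have hiff := jointArm_box_iff (n := n) (H := H) h0 hξ
    by_cases hA : (↑ξ : Percolation.BondConfig (BoxV 2 (n + 1))) ∈
        {ω : Percolation.BondConfig (BoxV 2 (n + 1)) | ∃ y ∈ boxBoundary 2 (n + 1),
          (Percolation.openGraph ω).Reachable (boxOrigin 2 (n + 1)) y}
    · have hj : jointArm ι n v (ξ.map (jBox ι n).sym2Map ∪ outEdges ι n H) := hiff.2 hA
      rw [if_pos hA]
      simp only [hμ, hj, if_true, one_mul]
    · have hj : ¬ jointArm ι n v (ξ.map (jBox ι n).sym2Map ∪ outEdges ι n H) := fun h => hA (hiff.1 h)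
      rw [if_neg hA]
      simp only [hμ, hj, if_false, zero_mul]
  rw [← hL, ← hR]
  exact key

end Comparison


/-! ### General position of the box, and the measure of a discrete Dobrushin domain -/

section General

variable {M : Type*} [Fintype M] [DecidableEq M] {H : SimpleGraph M} [DecidableRel H.Adj]
  {B : Set M} {p q : ℝ}

/-- Translations are automorphisms of `ℤ^d`. [folklore] -/
theorem zdGraph_adj_sub_iff {d : ℕ} (x y c : Site d) :
    (zdGraph d).Adj (x - c) (y - c) ↔ (zdGraph d).Adj x y := by
  rw [zdGraph_adj_iff, zdGraph_adj_iff]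
  refine exists_congr fun i => ?_
  rw [sub_add_eq_add_sub, sub_add_eq_add_sub, sub_left_inj, sub_left_inj]

variable (ι : M ↪ Site 2) (n : ℕ) in
/-- The arm event of the domain around `v`: `v` is joined to a vertex whose lattice position lies
on the sphere `∂(ι v + Λ_{n+1})` through open edges whose endpoints have lattice positions in the
ball `ι v + Λ_{n+1}`. [cite: Smirnov2010, Appendix A, proof of Lemma A.1 ("B connected to ∂Q inside Ω")] -/
def domainArmEvent (v : M) : Set (Percolation.BondConfig M) :=
  {ω | ∃ s : M, ι s - ι v ∈ innerBoundary (zdGraph 2) (box 2 (n + 1)) ∧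
    (fromEdgeSet {e | e ∈ ω ∧ ∀ x ∈ e, ι x - ι v ∈ box 2 (n + 1)}).Reachable v s}

/-- **Comparison between a lattice domain and the wired box.** For a finite graph `H` embedded in
`ℤ²` by `ι` (edges go to lattice edges), a wired set `B` whose points are at sup-distance more than
`n` from `ι v`, `0 ≤ p ≤ 1` and `q ≥ 1`: the `φ^B_{H,p,q}`-probability that `v` is joined to the
sphere of radius `n + 1` around it inside the ball is at most `φ¹_{Λ_{n+1},p,q}(0 ↔ ∂Λ_{n+1})`
(`thetaWiredBox`). From the centred form by translating `ι`.
[cite: Smirnov2010, Appendix A, proof of Lemma A.1; Grimmett2006, Lemma (4.13), Thm. (3.21)] -/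
theorem rcMeasure_real_domainArmEvent_le {ι : M ↪ Site 2} {n : ℕ}
    (hH : ∀ ⦃x y : M⦄, H.Adj x y → (zdGraph 2).Adj (ι x) (ι y)) (v : M)
    (hB : ∀ b ∈ B, ι b - ι v ∉ box 2 n) (hp : p ∈ Set.Icc (0 : ℝ) 1) (hq : 1 ≤ q) :
    (rcMeasure H p q B).real (domainArmEvent ι n v) ≤ thetaWiredBox 2 p q (n + 1) := by
  let ι' : M ↪ Site 2 := ⟨fun x => ι x - ι v, fun x y h => ι.injective (sub_left_injective h)⟩
  have hH' : ∀ ⦃x y : M⦄, H.Adj x y → (zdGraph 2).Adj (ι' x) (ι' y) := fun x y hxy =>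
    (zdGraph_adj_sub_iff _ _ _).2 (hH hxy)
  have h0 : ι' v = 0 := sub_self _
  exact rcMeasure_real_domainArmEvent₀_le (ι := ι') hH' h0 hB hp hq

end General

end Literature.Probability.LatticeModels

end
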